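import Mathlib
import HarnessLib
import Summits.ValiantsHypothesis.ValiantsHypothesis.Theorems.LacunarySymmetroidMatrixDescartesOsculationLawCommutingSheets

/-!
# ValiantsHypothesis / LacunarySymmetroid — crux `MatrixDescartes` (stmt-ValiantsHypothesis-18050, V1),
# line `Cruxes/MatrixDescartes/Lines/osculation_law.lean` («osculation-law»), rung O2 «DIAGONAL + RANK-ONE letters»
# (roster R2664; owner val-sym-mdr-p2 g19 = matrix layer, engine second hand = val-lit-p5 g13 per val-lit desk RULING #298 (2)):
# ENGINE part 1 — THE SECULAR DECOMPOSITION (Gram-rank 1: the first step off the commuting skeleton)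

Class: all letters DIAGONAL except ONE letter which is a RANK-ONE UPDATE of a diagonal matrix, `S l₀ = diagonal a₀ + w w'ᵀ`
(`Matrix.diagonal a₀ + Matrix.vecMulVec w w'`; `w' = w` is the PSD rank-one letter, `w' = −w` the NSD one — val-idea-crit-1 g2 VERDICT #68 (a)).
Then at every splitting `(r, s)` the pencil `Σ_l X₀^(d l)·S_l + X₁·(I_r ⊕ 0)` is «diagonal + rank-one»: `diagonal V + (X₀^(d l₀)·w) w'ᵀ`, with
the DIAGONAL SKELETON `V k = Σ_{l ≠ l₀} X₀^(d l)·(S l)_kk + X₀^(d l₀)·a₀ k + X₁·[k ∈ inl]` (sheets on the top block `inl`; on the bottom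
block `inr` the factors are `X₁`-free — the vertical lines of trop-p4 g16's O5 `osculationSet_fromBlocks`, p645356), and its determinant is

  `Φ = ∏_k V_k + X₀^(d l₀) · Σ_k w_k w'_k · ∏_{k' ≠ k} V_k'`       (`insertionPoly_diagonal_add_rankOne`)

— the skeleton's product of sheets PLUS the rank-one SECULAR term.  Ingredients:

* `det_diagonal_add_vecMulVec_sum` — the matrix determinant lemma for `diagonal v + vecMulVec w w'` over ANY commutative ring,
  WITHOUT invertibility of the diagonal (Mathlib's `Matrix.det_add_mul` and the tree's
  `Literature.AlgebraicGeometry.HyperbolicPolynomials.det_diagonal_add_vecMulVec` both need units; here the diagonal entries are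
  sheets): `det = ∏ v + Σ_i w_i w'_i ∏_{k≠i} v_k`, by row-multilinearity (`det_updateRow_add/_smul`), row reduction
  (`det_eq_of_forall_row_eq_smul_add_const`) and `adjugate_diagonal`.
* `det_updateRow_diagonal` — `det (updateRow (diagonal v) j r) = r j · ∏_{k≠j} v_k`.
* `osc_rankOne_single_support` — the degenerate corner `w = ω·e_{k₀}` IS a diagonal pencil: O1's
  `OsculationCommuting.osc_diagonal`-type count applies verbatim (via `sheetProduct_count`'s matrix form in the tree,
  `…OsculationCommutingDiagonal`; here only the IsDiag reduction is recorded).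

ENGINE part 2 — the COUNT of log-log inflections of the secular branches (one branch trapped between consecutive sheets of the
skeleton, Cauchy interlacing), uniform in `m` — is the O2 CONTENT and is NOT claimed here.

Honest framing: restricted-class ENGINE identities for a rung of an osculation line; `stub_osculationLaw` (the LAW),
`MatrixDescartes`, Conjecture B are OPEN; `VP ≠ VNP` is NOT proved.  No definitions, no named facts.
-/

set_option linter.dupNamespace false

noncomputable section

namespace Summit.ValiantsHypothesis.ValiantsHypothesis.Theorems.LacunarySymmetroidMatrixDescartes

namespace OsculationSecular

open Matrix
open scoped BigOperators

section CommRing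

variable {n R : Type*} [Fintype n] [DecidableEq n] [CommRing R]

/-- `det` of a diagonal matrix with one row replaced: `det (updateRow (diagonal v) j r) = r j · ∏_{k ≠ j} v k`. [folklore] -/
theorem det_updateRow_diagonal (v r : n → R) (j : n) :
    ((diagonal v).updateRow j r).det = r j * ∏ k ∈ Finset.univ.erase j, v k := by
  rw [det_eq_sum_mul_adjugate_row _ j]
  have hadj : ∀ l, adjugate ((diagonal v).updateRow j r) l j = adjugate (diagonal v) l j := by
    intro l
    rw [adjugate_apply, adjugate_apply, updateRow_idem]
  simp_rw [hadj, adjugate_diagonal, diagonal_apply, updateRow_self]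
  rw [Finset.sum_eq_single j (fun l _ hl => by rw [if_neg hl, mul_zero]) (fun h => (h (Finset.mem_univ j)).elim), if_pos rfl]

/-- **Matrix determinant lemma for `diagonal + rank one`, over any commutative ring (no invertibility):**
`det (diagonal v + vecMulVec w w') = ∏ v + Σ_i w_i·w'_i·∏_{k≠i} v_k`. [folklore] -/
theorem det_diagonal_add_vecMulVec_sum (v w w' : n → R) :
    (diagonal v + vecMulVec w w').det = ∏ i, v i + ∑ i, w i * w' i * ∏ k ∈ Finset.univ.erase i, v k := by
  classical
  -- partial rank-one updates: rows in `S` carry `v_i e_i + w_i w'`, the others `v_i e_i`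
  set M : Finset n → Matrix n n R := fun S => Matrix.of fun i j => (if i = j then v i else 0) + (if i ∈ S then w i * w' j else 0)
    with hM
  have hclaim : ∀ S : Finset n, (M S).det = ∏ i, v i + ∑ i ∈ S, w i * w' i * ∏ k ∈ Finset.univ.erase i, v k := by
    intro S
    induction S using Finset.induction_on with
    | empty =>
      have h0 : M ∅ = diagonal v := by
        ext i j; simp [hM, diagonal_apply]
      rw [h0, det_diagonal, Finset.sum_empty, add_zero]
    | insert j S hj ih =>
      -- row `j` of `M S` is `v_j e_j`; the new matrix updates it by `+ w_j • w'`
      have hrowj : (M S) j = fun l => if j = l then v j else 0 := by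
        ext l; simp [hM, hj]
      have hins : M (insert j S) = (M S).updateRow j ((M S) j + w j • w') := by
        ext i l
        rw [updateRow_apply]
        by_cases hij : i = j
        · subst hij
          simp [hM, hj]
        · simp [hM, hij, Finset.mem_insert]
      have hN : ((M S).updateRow j w').det = ((diagonal v).updateRow j w').det := by
        refine det_eq_of_forall_row_eq_smul_add_const (fun i => if i ∈ S then w i else 0) j (by simp [hj]) ?_
        intro i l
        rw [updateRow_apply, updateRow_apply, updateRow_self]
        by_cases hij : i = j
        · subst hij; simp [hj]
        · rw [if_neg hij, if_neg hij, diagonal_apply]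
          simp only [hM, Matrix.of_apply]
          by_cases hiS : i ∈ S
          · simp [hiS]
          · simp [hiS]
      rw [hins, det_updateRow_add, updateRow_eq_self, det_updateRow_smul, hN, det_updateRow_diagonal, ih,
        Finset.sum_insert hj]
      ring
  have hfull : diagonal v + vecMulVec w w' = M Finset.univ := by
    ext i j
    simp [hM, diagonal_apply, vecMulVec_apply]
  rw [hfull, hclaim]

end CommRing

/-! ### The insertion polynomial of «diagonal letters + one rank-one letter» -/

open Polynomial

/-- The pencil of the class is `diagonal V + (X₀^(d l₀)·w) w'ᵀ` with the diagonal skeleton `V`. [folklore] -/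
theorem pencil_diagonal_add_rankOne (r s K : ℕ) (d : Fin K → ℕ) (S : Fin K → Matrix (Fin r ⊕ Fin s) (Fin r ⊕ Fin s) ℝ)
    (l₀ : Fin K) (a₀ w w' : Fin r ⊕ Fin s → ℝ) (hS : ∀ l, l ≠ l₀ → (S l).IsDiag)
    (h₀ : S l₀ = Matrix.diagonal a₀ + Matrix.vecMulVec w w') :
    (∑ l, (MvPolynomial.X (0 : Fin 2) : MvPolynomial (Fin 2) ℝ) ^ d l •
              (S l).map (MvPolynomial.C : ℝ →+* MvPolynomial (Fin 2) ℝ)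
            + (MvPolynomial.X (1 : Fin 2) : MvPolynomial (Fin 2) ℝ) •
              (Matrix.fromBlocks 1 0 0 0 : Matrix (Fin r ⊕ Fin s) (Fin r ⊕ Fin s) ℝ).map
                (MvPolynomial.C : ℝ →+* MvPolynomial (Fin 2) ℝ)) =
      Matrix.diagonal (fun k => (∑ l ∈ Finset.univ.erase l₀, (MvPolynomial.X (0 : Fin 2) : MvPolynomial (Fin 2) ℝ) ^ d l *
          MvPolynomial.C (S l k k)) + (MvPolynomial.X (0 : Fin 2) : MvPolynomial (Fin 2) ℝ) ^ d l₀ * MvPolynomial.C (a₀ k) +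
          MvPolynomial.X 1 * Sum.elim (fun _ => 1) (fun _ => 0) k) +
        Matrix.vecMulVec (fun k => (MvPolynomial.X (0 : Fin 2) : MvPolynomial (Fin 2) ℝ) ^ d l₀ * MvPolynomial.C (w k))
          (fun k => MvPolynomial.C (w' k)) := by
  classical
  ext k k'
  simp only [Matrix.add_apply, Matrix.sum_apply, Matrix.smul_apply, Matrix.map_apply, smul_eq_mul, Matrix.vecMulVec_apply,
    Matrix.diagonal_apply]
  rw [← Finset.add_sum_erase _ _ (Finset.mem_univ l₀), h₀, Matrix.add_apply, Matrix.vecMulVec_apply, Matrix.diagonal_apply,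
    map_add, map_mul]
  have hproj : (Matrix.fromBlocks 1 0 0 0 : Matrix (Fin r ⊕ Fin s) (Fin r ⊕ Fin s) ℝ) k k' =
      if k = k' then Sum.elim (fun _ => (1 : ℝ)) (fun _ => 0) k else 0 := by
    rcases k with i | j <;> rcases k' with i' | j'
    · by_cases h : i = i'
      · subst h; simp
      · have : (Sum.inl i : Fin r ⊕ Fin s) ≠ Sum.inl i' := fun e => h (Sum.inl_injective e)
        simp [Matrix.one_apply_ne h, this]
    · simp
    · simp
    · by_cases h : j = j'
      · subst h; simp
      · have : (Sum.inr j : Fin r ⊕ Fin s) ≠ Sum.inr j' := fun e => h (Sum.inr_injective e)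
        simp [this]
  rw [hproj]
  by_cases hkk : k = k'
  · subst hkk
    simp only [if_true]
    rcases k with i | j
    · simp only [Sum.elim_inl, map_one, mul_one]; ring
    · simp only [Sum.elim_inr, map_zero, mul_zero, add_zero]; ring
  · rw [if_neg hkk, if_neg hkk, if_neg hkk]
    have hdiag0 : ∀ l ∈ Finset.univ.erase l₀, (MvPolynomial.X (0 : Fin 2) : MvPolynomial (Fin 2) ℝ) ^ d l *
        MvPolynomial.C (S l k k') = 0 := by
      intro l hl
      rw [(hS l (Finset.mem_erase.1 hl).1) hkk, map_zero, mul_zero]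
    rw [Finset.sum_eq_zero hdiag0]
    simp only [map_zero, mul_zero, add_zero, zero_add]
    ring

set_option maxHeartbeats 400000 in
/-- ★ **The secular decomposition** of the insertion polynomial of «diagonal letters + one letter `diagonal a₀ + w w'ᵀ`» (line
vocabulary `insertionPoly` unfolded verbatim, every splitting `(r,s)`): `Φ = ∏_k V_k + X₀^(d l₀)·Σ_k w_k w'_k·∏_{k'≠k} V_{k'}` with the
diagonal skeleton `V_k = Σ_{l≠l₀} X₀^(d l)·(S l)_kk + X₀^(d l₀)·a₀ k + X₁·[k ∈ inl]`. [folklore] -/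
theorem insertionPoly_diagonal_add_rankOne (r s K : ℕ) (d : Fin K → ℕ)
    (S : Fin K → Matrix (Fin r ⊕ Fin s) (Fin r ⊕ Fin s) ℝ) (l₀ : Fin K) (a₀ w w' : Fin r ⊕ Fin s → ℝ)
    (hS : ∀ l, l ≠ l₀ → (S l).IsDiag) (h₀ : S l₀ = Matrix.diagonal a₀ + Matrix.vecMulVec w w') :
    (∑ l, (MvPolynomial.X (0 : Fin 2) : MvPolynomial (Fin 2) ℝ) ^ d l •
              (S l).map (MvPolynomial.C : ℝ →+* MvPolynomial (Fin 2) ℝ)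
            + (MvPolynomial.X (1 : Fin 2) : MvPolynomial (Fin 2) ℝ) •
              (Matrix.fromBlocks 1 0 0 0 : Matrix (Fin r ⊕ Fin s) (Fin r ⊕ Fin s) ℝ).map
                (MvPolynomial.C : ℝ →+* MvPolynomial (Fin 2) ℝ)).det =
      (∏ k, ((∑ l ∈ Finset.univ.erase l₀, (MvPolynomial.X (0 : Fin 2) : MvPolynomial (Fin 2) ℝ) ^ d l *
          MvPolynomial.C (S l k k)) + (MvPolynomial.X (0 : Fin 2) : MvPolynomial (Fin 2) ℝ) ^ d l₀ * MvPolynomial.C (a₀ k) +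
          MvPolynomial.X 1 * Sum.elim (fun _ => 1) (fun _ => 0) k)) +
      (MvPolynomial.X (0 : Fin 2) : MvPolynomial (Fin 2) ℝ) ^ d l₀ *
        ∑ k, MvPolynomial.C (w k * w' k) * ∏ k' ∈ Finset.univ.erase k,
          ((∑ l ∈ Finset.univ.erase l₀, (MvPolynomial.X (0 : Fin 2) : MvPolynomial (Fin 2) ℝ) ^ d l *
            MvPolynomial.C (S l k' k')) + (MvPolynomial.X (0 : Fin 2) : MvPolynomial (Fin 2) ℝ) ^ d l₀ * MvPolynomial.C (a₀ k') +
            MvPolynomial.X 1 * Sum.elim (fun _ => 1) (fun _ => 0) k') := by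
  classical
  rw [pencil_diagonal_add_rankOne r s K d S l₀ a₀ w w' hS h₀, det_diagonal_add_vecMulVec_sum, Finset.mul_sum]
  congr 1
  refine Finset.sum_congr rfl fun k _ => ?_
  rw [map_mul]
  ring

/-- The degenerate corner: if the rank-one vector is supported on ONE coordinate, the rank-one letter is DIAGONAL, so the whole
pencil is in O1's class (`OsculationCommuting.osc_diagonal` in `…OsculationCommutingDiagonal` then counts it). [folklore] -/
theorem isDiag_vecMulVec_of_single_support {n : Type*} [DecidableEq n] (w : n → ℝ) (k₀ : n) (hw : ∀ k, k ≠ k₀ → w k = 0) :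
    (Matrix.vecMulVec w w).IsDiag := by
  intro i j hij
  rw [Matrix.vecMulVec_apply]
  by_cases hi : i = k₀
  · have hj : j ≠ k₀ := fun h => hij (hi.trans h.symm)
    rw [hw j hj, mul_zero]
  · rw [hw i hi, zero_mul]

end OsculationSecular

end Summit.ValiantsHypothesis.ValiantsHypothesis.Theorems.LacunarySymmetroidMatrixDescartes

end
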